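import Summits.ABC.StewartYu.ArchG3PackClosedVD
import HarnessLib

/-!
# Cell abc-stewartyu, rung A1.L (crux r2 `ArchCoreRat`), WP-L.A: the Kummer HALF-STEP record package at `S(θ)` from LOG-LINEAR LINES
# (the «lines» layer of `stub_packsArch`, R38 (3); companion of `ArchG3PackLinesV`, independent of it)

`Summits/ABC/StewartYu/ArchG3PackLinesVH.lean` — cell `abc-stewartyu` (HOME `run/shared/lean/pub/abc-stewartyu/`; seat p5 g8).  Theorems on
`ArchG3Setup`; no definition, no named fact, no record.  The half-step's inequality has the shape
`e^{γb(3N+2)}·(J + F) + Ch < Mb/(4·Dh·Mb·(∏H(θⱼ))²)^{2ⁿ}`, `Mb = 1 + #U·P·DΔ·Mt`; with `log Mb ≤ log 2 + cU + cP + log DΔ + log Mt` (all four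
factors `≥ 1`) and `log Mb ≥ 0` the right-hand side is `≥ e^{−Θ}`,
`Θ = 2ⁿ·(log 4 + cD + (log 2 + cU + cP + log DΔ + log Mt) + 2·cH)` (`log Dh ≤ cD`, `log ∏H(θⱼ) ≤ cH`), so three log lines
`ℓ_part + Θ + log 3 ≤ 0` suffice (print's closing comparison of §4.3: far smallness versus the `2ⁿ`-fold height of `K = ℚ(√θ)`).

* `halfstep_ineq_of_logLines` — the generic real-variable statement;
* **`archHalfStepHypD_of_logLinesV`** — `ArchHalfStepHypD R R′ U L P w γb c e c′ δ₀ V N N₁ T T′` at `S(θ)` (V := virtual box,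
  `Dh := ν(H)^a·Dhv`, `Mt := MtV`, `cD(s,a) = (23/20)aH + |s|Σ(Bvⱼ/N)Vⱼ + Σ(colUⱼ/N)Vⱼ + 2ΣVⱼ`, `cH` any ceiling of `log ∏H(θⱼ)` — e.g.
  `SatData.log_heightProd_le_of_sat`) from the schedule data, the ceilings and the lines (J)/(F)/(C) per odd `s` and `a < T′`.

WHAT THIS IS NOT: the lines themselves (record `ArchG3RecA/B`, seat p1); no crux moves.

## References
* Yu. V. Nesterenko, LNM 1819 (2003) — §4.3 (4.36)–(4.51), esp. (4.45) and Lemma 3.11 over `K`, p. 90–95. [Nesterenko2003]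
* M. Waldschmidt, Acta Arith. 37 (1980) — Lemma 2.2 (the `2ᵏ`-exponent threshold). [Waldschmidt1980]
-/

noncomputable section

open Finset Polynomial
open scoped Matrix
open Literature.NumberTheory.Transcendental
open Literature.NumberTheory.Transcendental.CW77 (heightProd)
open Literature.NumberTheory.Transcendental.CW77.Setup (Tau tauNorm)
open Summit.ABC.StewartYu.ArchSupply (scaledFeldR WC)
open scoped Nat

namespace Summit.ABC.StewartYu

namespace ArchG3Setup

variable (S : ArchG3Setup) {K : Type*}

/-! ### Bookkeeping -/

/-- `a ≤ e^u`, `b ≤ e^v`, `0 ≤ a` ⇒ `a·b ≤ e^{u+v}` (left-nonnegative form). [folklore] -/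
theorem mul_le_exp_add_of_nonneg_left {a b u v : ℝ} (ha : a ≤ Real.exp u) (hb : b ≤ Real.exp v) (ha0 : 0 ≤ a) :
    a * b ≤ Real.exp (u + v) := by
  rw [Real.exp_add]
  exact (mul_le_mul_of_nonneg_left hb ha0).trans (mul_le_mul_of_nonneg_right ha (Real.exp_pos v).le)

/-! ### The threshold from below -/

/-- **The Liouville threshold from below**: with `Mb = 1 + Uc·(P·DΔ)·Mt` (`Uc, P, DΔ, Mt ≥ 1`), `Dn, hP ≥ 1`, `log Dn ≤ cD`, `log hP ≤ cH`,
`Uc ≤ e^{cU}`, `P ≤ e^{cP}`:  `e^{−Θ} ≤ Mb/(4·Dn·Mb·hP²)^{2ⁿ}`, `Θ = 2ⁿ·(log 4 + cD + (log 2 + cU + cP + log DΔ + log Mt) + 2cH)`.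
[cite: Waldschmidt1980, Lemma 2.2; shape only] -/
theorem exp_neg_le_threshold {n Uc Dn : ℕ} {P DΔ Mt Hp cU cP cD cH : ℝ} (hUc : 1 ≤ Uc) (hP1 : 1 ≤ P) (hDΔ1 : 1 ≤ DΔ)
    (hMt1 : 1 ≤ Mt) (hDn : 1 ≤ Dn) (hhP : 1 ≤ Hp) (hU : (Uc : ℝ) ≤ Real.exp cU) (hP : P ≤ Real.exp cP)
    (hD : Real.log Dn ≤ cD) (hH : Real.log Hp ≤ cH) :
    Real.exp (-((2 : ℝ) ^ n * (Real.log 4 + cD + (Real.log 2 + cU + cP + Real.log DΔ + Real.log Mt) + 2 * cH))) ≤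
      (1 + Uc * (P * DΔ) * Mt) / (4 * (Dn : ℝ) * (1 + Uc * (P * DΔ) * Mt) * Hp ^ 2) ^ (2 ^ n) := by
  have hUc1 : (1 : ℝ) ≤ Uc := by exact_mod_cast hUc
  have hDn1 : (1 : ℝ) ≤ Dn := by exact_mod_cast hDn
  set x : ℝ := Uc * (P * DΔ) * Mt with hx
  have hx1 : 1 ≤ x := by
    have h1 : (1 : ℝ) ≤ Uc * (P * DΔ) := one_le_mul_of_one_le_of_one_le hUc1 (one_le_mul_of_one_le_of_one_le hP1 hDΔ1)
    exact one_le_mul_of_one_le_of_one_le h1 hMt1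
  have hMb1 : 1 ≤ 1 + x := by linarith
  have hMb0 : 0 < 1 + x := by linarith
  have hbase1 : 1 ≤ 4 * (Dn : ℝ) * (1 + x) * Hp ^ 2 := by
    have := one_le_pow₀ (n := 2) hhP
    have h4 : (1 : ℝ) ≤ 4 * Dn := by nlinarith
    exact one_le_mul_of_one_le_of_one_le (one_le_mul_of_one_le_of_one_le h4 hMb1) this
  have hbase0 : 0 < 4 * (Dn : ℝ) * (1 + x) * Hp ^ 2 := lt_of_lt_of_le one_pos hbase1
  -- log Mb ≤ log 2 + cU + cP + log DΔ + log Mt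
  have hxlog : Real.log x ≤ cU + cP + Real.log DΔ + Real.log Mt := by
    have hDΔ0 : 0 < DΔ := by linarith
    have hMt0 : 0 < Mt := by linarith
    have hP0 : 0 < P := by linarith
    have hUc0 : (0 : ℝ) < Uc := by linarith
    rw [hx, Real.log_mul (by positivity) hMt0.ne', Real.log_mul hUc0.ne' (by positivity), Real.log_mul hP0.ne' hDΔ0.ne']
    have h1 : Real.log Uc ≤ cU := (Real.log_le_iff_le_exp hUc0).mpr hU
    have h2 : Real.log P ≤ cP := (Real.log_le_iff_le_exp hP0).mpr hP
    linarith
  have hMblog : Real.log (1 + x) ≤ Real.log 2 + cU + cP + Real.log DΔ + Real.log Mt := by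
    have h1 : Real.log (1 + x) ≤ Real.log (2 * x) := Real.log_le_log hMb0 (by linarith)
    rw [Real.log_mul (by norm_num) (by linarith)] at h1
    linarith
  have hMblog0 : 0 ≤ Real.log (1 + x) := Real.log_nonneg hMb1
  -- log base ≤ log 4 + cD + cMb + 2 cH
  have hbase : Real.log (4 * (Dn : ℝ) * (1 + x) * Hp ^ 2) ≤
      Real.log 4 + cD + (Real.log 2 + cU + cP + Real.log DΔ + Real.log Mt) + 2 * cH := by
    rw [Real.log_mul (by positivity) (by positivity), Real.log_mul (by positivity) hMb0.ne', Real.log_mul (by norm_num) (by positivity),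
      Real.log_pow]
    push_cast
    linarith
  -- the threshold as an exponential
  have hthr : (1 + x) / (4 * (Dn : ℝ) * (1 + x) * Hp ^ 2) ^ (2 ^ n) =
      Real.exp (Real.log (1 + x) - (2 : ℝ) ^ n * Real.log (4 * (Dn : ℝ) * (1 + x) * Hp ^ 2)) := by
    rw [Real.exp_sub, Real.exp_log hMb0, show (2 : ℝ) ^ n = ((2 ^ n : ℕ) : ℝ) by push_cast; rfl, Real.exp_nat_mul,
      Real.exp_log hbase0]
  rw [hthr]
  refine Real.exp_le_exp.mpr ?_
  have h2n : (0 : ℝ) ≤ (2 : ℝ) ^ n := by positivity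
  nlinarith [mul_le_mul_of_nonneg_left hbase h2n]

/-! ### The half-step inequality from three log lines -/

/-- **The half-step's inequality at `(s, a)` from the lines (J)/(F)/(C)** (generic real letters; `Θ` as in `exp_neg_le_threshold`).
[cite: Nesterenko2003, §4.3 (4.45) with Lemma 3.11 over K, p. 92–93; shape only] -/
theorem halfstep_ineq_of_logLines {n N t a : ℕ} (ht : 1 ≤ t) {γb w C E DΔ Wn Wd Wh P δ₀ Lj SΓ Mt Hp : ℝ} {Uc Dn : ℕ}
    (hC : 1 ≤ C) (hE : 1 ≤ E) (hDΔ1 : 1 ≤ DΔ) (hWn : 0 < Wn) (hWd : 0 < Wd) (hWh : 0 < Wh) (hMt1 : 1 ≤ Mt) (hP1 : 1 ≤ P)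
    (hUc : 1 ≤ Uc) (hhP : 1 ≤ Hp) (hDn : 1 ≤ Dn)
    {cU cP cb cbh cD cH : ℝ} (hU : (Uc : ℝ) ≤ Real.exp cU) (hP : P ≤ Real.exp cP)
    (hb : 2 * (Lj * δ₀ * N) ≤ Real.exp cb) (hbh : 2 * (Lj * δ₀ * (3 * N + 2)) ≤ Real.exp cbh)
    (hD : Real.log Dn ≤ cD) (hH : Real.log Hp ≤ cH)
    (hJ : γb * (3 * N + 2) + Real.log (2 * ((2 * N + 1 : ℕ) : ℝ) ^ (t + 1) * t * (20 * Real.exp 1) ^ ((2 * N + 1) * t)) +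
        t * Real.log (2 * C) + γb * (N + 1) + a * Real.log 2 + SΓ / C + cU + cP + Real.log DΔ + Real.log Wn + (γb + w) * N + cb +
        (2 : ℝ) ^ n * (Real.log 4 + cD + (Real.log 2 + cU + cP + Real.log DΔ + Real.log Mt) + 2 * cH) + Real.log 3 ≤ 0)
    (hF : γb * (3 * N + 2) + cU + cP + Real.log DΔ + Real.log Wd + (w + Lj * δ₀) * ((3 * E + 1) * (2 * N + 1) + N) -
        ((2 * N + 1) * t : ℕ) * Real.log E +
        (2 : ℝ) ^ n * (Real.log 4 + cD + (Real.log 2 + cU + cP + Real.log DΔ + Real.log Mt) + 2 * cH) + Real.log 3 ≤ 0)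
    (hCmp : cU + cP + Real.log DΔ + Real.log Wh + (γb + w) * (3 * N + 2) + cbh +
        (2 : ℝ) ^ n * (Real.log 4 + cD + (Real.log 2 + cU + cP + Real.log DΔ + Real.log Mt) + 2 * cH) + Real.log 3 < 0) :
    Real.exp (γb * (3 * N + 2)) *
          (2 * ((2 * N + 1 : ℕ) : ℝ) ^ (t + 1) * t * (20 * Real.exp 1) ^ ((2 * N + 1) * t) *
              ((2 * C) ^ t * Real.exp (γb * (N + 1)) *
                ((2 : ℝ) ^ a * Real.exp (SΓ / C) *
                  (Uc * (P * DΔ) * Wn * Real.exp ((γb + w) * N) * (2 * (Lj * δ₀ * N))))) +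
            Uc * (P * DΔ) * Wd * Real.exp ((w + Lj * δ₀) * ((3 * E + 1) * (2 * N + 1) + N)) * (1 / E) ^ ((2 * N + 1) * t)) +
        Uc * (P * DΔ) * Wh * Real.exp ((γb + w) * (3 * N + 2)) * (2 * (Lj * δ₀ * (3 * N + 2))) <
      (1 + Uc * (P * DΔ) * Mt) / (4 * (Dn : ℝ) * (1 + Uc * (P * DΔ) * Mt) * Hp ^ 2) ^ (2 ^ n) := by
  set Θ : ℝ := (2 : ℝ) ^ n * (Real.log 4 + cD + (Real.log 2 + cU + cP + Real.log DΔ + Real.log Mt) + 2 * cH) with hΘ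
  have hthr := exp_neg_le_threshold (n := n) hUc hP1 hDΔ1 hMt1 hDn hhP hU hP hD hH
  have ht0 : (0 : ℝ) < t := by exact_mod_cast ht
  have hHm : 0 < 2 * ((2 * N + 1 : ℕ) : ℝ) ^ (t + 1) * t * (20 * Real.exp 1) ^ ((2 * N + 1) * t) := by positivity
  have hC0 : 0 < C := by linarith
  have hE0 : 0 < E := by linarith
  have hDΔ : 0 < DΔ := by linarith
  have hP0 : 0 ≤ P := by linarith
  have eCt : (2 * C) ^ t = Real.exp (t * Real.log (2 * C)) := by
    rw [← Real.log_pow, Real.exp_log (by positivity)]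
  have e2a : (2 : ℝ) ^ a = Real.exp (a * Real.log 2) := by
    rw [← Real.log_pow, Real.exp_log (by positivity)]
  have eE : (1 / E) ^ ((2 * N + 1) * t) = Real.exp (-(((2 * N + 1) * t : ℕ) * Real.log E)) := by
    rw [one_div, inv_pow, Real.exp_neg, ← Real.log_pow, Real.exp_log (pow_pos hE0 _)]
  have hPD : P * DΔ ≤ Real.exp (cP + Real.log DΔ) := mul_le_exp_add_of_nonneg_left hP ((Real.exp_log hDΔ).ge) hP0
  have hPD0 : 0 ≤ P * DΔ := mul_nonneg hP0 hDΔ.le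
  have hUc0 : (0 : ℝ) ≤ Uc := Nat.cast_nonneg _
  have core : ∀ {W : ℝ} (hW : 0 < W) (ex : ℝ), (Uc : ℝ) * (P * DΔ) * W * Real.exp ex ≤
      Real.exp (cU + (cP + Real.log DΔ) + Real.log W + ex) := fun hW ex =>
    mul_le_exp_add_of_nonneg_left (mul_le_exp_add_of_nonneg_left (mul_le_exp_add_of_nonneg_left hU hPD hUc0)
      ((Real.exp_log hW).ge) (mul_nonneg hUc0 hPD0)) le_rfl (by positivity)
  -- each part ≤ e^{−Θ}/3 ≤ threshold/3
  have third : ∀ {X ℓ : ℝ}, X ≤ Real.exp ℓ → ℓ + Θ + Real.log 3 ≤ 0 →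
      X ≤ (1 + Uc * (P * DΔ) * Mt) / (4 * (Dn : ℝ) * (1 + Uc * (P * DΔ) * Mt) * Hp ^ 2) ^ (2 ^ n) / 3 := by
    intro X ℓ hX hℓ
    refine hX.trans ?_
    have h1 : Real.exp ℓ ≤ Real.exp (-Θ - Real.log 3) := Real.exp_le_exp.mpr (by linarith)
    refine h1.trans ?_
    rw [Real.exp_sub, Real.exp_log (by norm_num)]
    exact div_le_div_of_nonneg_right hthr (by norm_num)
  have thirdlt : ∀ {X ℓ : ℝ}, X ≤ Real.exp ℓ → ℓ + Θ + Real.log 3 < 0 →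
      X < (1 + Uc * (P * DΔ) * Mt) / (4 * (Dn : ℝ) * (1 + Uc * (P * DΔ) * Mt) * Hp ^ 2) ^ (2 ^ n) / 3 := by
    intro X ℓ hX hℓ
    refine lt_of_le_of_lt hX ?_
    have h1 : Real.exp ℓ < Real.exp (-Θ - Real.log 3) := Real.exp_lt_exp.mpr (by linarith)
    refine lt_of_lt_of_le h1 ?_
    rw [Real.exp_sub, Real.exp_log (by norm_num)]
    exact div_le_div_of_nonneg_right hthr (by norm_num)
  -- (J)
  have hJb : Real.exp (γb * (3 * N + 2)) *
      (2 * ((2 * N + 1 : ℕ) : ℝ) ^ (t + 1) * t * (20 * Real.exp 1) ^ ((2 * N + 1) * t) *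
        ((2 * C) ^ t * Real.exp (γb * (N + 1)) *
          ((2 : ℝ) ^ a * Real.exp (SΓ / C) * (Uc * (P * DΔ) * Wn * Real.exp ((γb + w) * N) * (2 * (Lj * δ₀ * N)))))) ≤
      (1 + Uc * (P * DΔ) * Mt) / (4 * (Dn : ℝ) * (1 + Uc * (P * DΔ) * Mt) * Hp ^ 2) ^ (2 ^ n) / 3 := by
    have h1 := mul_le_exp_add_of_nonneg_left (core hWn ((γb + w) * N)) hb (by positivity)
    have h2 : (2 : ℝ) ^ a * Real.exp (SΓ / C) * ((Uc : ℝ) * (P * DΔ) * Wn * Real.exp ((γb + w) * N) * (2 * (Lj * δ₀ * N))) ≤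
        Real.exp (a * Real.log 2 + SΓ / C + (cU + (cP + Real.log DΔ) + Real.log Wn + (γb + w) * N + cb)) :=
      mul_le_exp_add_of_nonneg_left (by rw [e2a, ← Real.exp_add]) h1 (by positivity)
    have h3 := mul_le_exp_add_of_nonneg_left (show (2 * C) ^ t * Real.exp (γb * (N + 1)) ≤ Real.exp (t * Real.log (2 * C) + γb * (N + 1)) by
      rw [eCt, ← Real.exp_add]) h2 (by positivity)
    have h4 := mul_le_exp_add_of_nonneg_left ((Real.exp_log hHm).ge) h3 (by positivity)
    have h5 := mul_le_exp_add_of_nonneg_left (le_refl (Real.exp (γb * (3 * N + 2)))) h4 (by positivity)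
    exact third h5 (by linarith)
  -- (F)
  have hFb : Real.exp (γb * (3 * N + 2)) *
      ((Uc : ℝ) * (P * DΔ) * Wd * Real.exp ((w + Lj * δ₀) * ((3 * E + 1) * (2 * N + 1) + N)) * (1 / E) ^ ((2 * N + 1) * t)) ≤
      (1 + Uc * (P * DΔ) * Mt) / (4 * (Dn : ℝ) * (1 + Uc * (P * DΔ) * Mt) * Hp ^ 2) ^ (2 ^ n) / 3 := by
    have h1 : (Uc : ℝ) * (P * DΔ) * Wd * Real.exp ((w + Lj * δ₀) * ((3 * E + 1) * (2 * N + 1) + N)) * (1 / E) ^ ((2 * N + 1) * t) ≤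
        Real.exp (cU + (cP + Real.log DΔ) + Real.log Wd + (w + Lj * δ₀) * ((3 * E + 1) * (2 * N + 1) + N) +
          -(((2 * N + 1) * t : ℕ) * Real.log E)) := mul_le_exp_add_of_nonneg_left (core hWd _) (by rw [eE]) (by positivity)
    have h2 := mul_le_exp_add_of_nonneg_left (le_refl (Real.exp (γb * (3 * N + 2)))) h1 (by positivity)
    exact third h2 (by linarith)
  -- (C)
  have hCb : (Uc : ℝ) * (P * DΔ) * Wh * Real.exp ((γb + w) * (3 * N + 2)) * (2 * (Lj * δ₀ * (3 * N + 2))) <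
      (1 + Uc * (P * DΔ) * Mt) / (4 * (Dn : ℝ) * (1 + Uc * (P * DΔ) * Mt) * Hp ^ 2) ^ (2 ^ n) / 3 := by
    have h1 := mul_le_exp_add_of_nonneg_left (core hWh ((γb + w) * (3 * N + 2))) hbh (by positivity)
    exact thirdlt h1 (by linarith)
  have hsplit : Real.exp (γb * (3 * N + 2)) *
      (2 * ((2 * N + 1 : ℕ) : ℝ) ^ (t + 1) * t * (20 * Real.exp 1) ^ ((2 * N + 1) * t) *
          ((2 * C) ^ t * Real.exp (γb * (N + 1)) *
            ((2 : ℝ) ^ a * Real.exp (SΓ / C) * (Uc * (P * DΔ) * Wn * Real.exp ((γb + w) * N) * (2 * (Lj * δ₀ * N))))) +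
        Uc * (P * DΔ) * Wd * Real.exp ((w + Lj * δ₀) * ((3 * E + 1) * (2 * N + 1) + N)) * (1 / E) ^ ((2 * N + 1) * t)) =
      Real.exp (γb * (3 * N + 2)) *
        (2 * ((2 * N + 1 : ℕ) : ℝ) ^ (t + 1) * t * (20 * Real.exp 1) ^ ((2 * N + 1) * t) *
          ((2 * C) ^ t * Real.exp (γb * (N + 1)) *
            ((2 : ℝ) ^ a * Real.exp (SΓ / C) * (Uc * (P * DΔ) * Wn * Real.exp ((γb + w) * N) * (2 * (Lj * δ₀ * N)))))) +
      Real.exp (γb * (3 * N + 2)) *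
        (Uc * (P * DΔ) * Wd * Real.exp ((w + Lj * δ₀) * ((3 * E + 1) * (2 * N + 1) + N)) * (1 / E) ^ ((2 * N + 1) * t)) := by
    ring
  rw [hsplit]
  linarith

/-! ### The half-step package at `S(θ)` from the lines -/

/-- `1 ≤ DΔC`. [folklore] -/
theorem one_le_DΔC {Y : ℝ} (hY : 0 ≤ Y) (T' : ℕ) : 1 ≤ DΔC Y T' := by
  unfold DΔC
  refine one_le_pow₀ ?_
  have h1 : (1 : ℝ) ≤ Real.exp 1 := by
    have := Real.add_one_le_exp (1 : ℝ)
    linarith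
  have h0 : 0 ≤ Y / T' := by positivity
  nlinarith

/-- `1 ≤ WC` (`H ≥ 1`, `ρ ≥ 0`). [folklore] -/
theorem one_le_WC {H : ℕ} (hH : 1 ≤ H) (ex L₀ Nord : ℕ) {ρ : ℝ} (hρ : 0 ≤ ρ) : 1 ≤ WC H ex L₀ Nord ρ := by
  unfold WC
  have hH' : (0 : ℝ) < H := by exact_mod_cast hH
  have h1 : (1 : ℝ) ≤ (2 : ℝ) ^ (ex * Nord) := one_le_pow₀ (by norm_num)
  have h2 : (1 : ℝ) ≤ Real.exp (H / Real.exp 1) := Real.one_le_exp_iff.mpr (by positivity)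
  have he : (1 : ℝ) ≤ Real.exp 1 := Real.one_le_exp_iff.mpr zero_le_one
  have h3 : (1 : ℝ) ≤ (Real.exp 1 * (1 + (2 : ℝ) ^ ex * ρ / H)) ^ L₀ := by
    refine one_le_pow₀ ?_
    have : (0 : ℝ) ≤ (2 : ℝ) ^ ex * ρ / H := by positivity
    nlinarith
  exact one_le_mul_of_one_le_of_one_le h1 (one_le_mul_of_one_le_of_one_le h2 h3)

/-- `1 ≤ MtV` when `0 ≤ Λb` and `0 ≤ Aₖ`. [folklore] -/
theorem one_le_MtV {A : Fin S.n → ℝ} (hA : ∀ k, 0 ≤ A k) {H : ℕ} (hH : 1 ≤ H) (ex L₀ T' N₁ : ℕ) {Λb : ℝ} (hΛ : 0 ≤ Λb) :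
    1 ≤ S.MtV A H ex L₀ T' N₁ Λb := by
  unfold MtV
  refine one_le_mul_of_one_le_of_one_le (one_le_WC hH (ex + 1) L₀ T' (Nat.cast_nonneg N₁)) ?_
  have hs : 0 ≤ ∑ k, A k := sum_nonneg fun k _ => hA k
  exact Real.one_le_exp_iff.mpr (by positivity)

/-- **`ArchHalfStepHypD` at `S(θ)` from three log lines per odd `s` and `a < T′`** (V := virtual box, `Dh := ν(H)^a·Dhv Bv`, `Mt := MtV`,
slab-quantified sizes).  `cH` is any ceiling of `log ∏H(θⱼ)` (e.g. `SatData.log_heightProd_le_of_sat`), `cD(s,a)` the virtual denominator ceiling.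
[cite: Nesterenko2003, §4.3 (4.36)–(4.51); shape only] -/
theorem archHalfStepHypD_of_logLinesV (F : S.SatData) {H : ℕ} (hH : 1 ≤ H) (ex L₀ : ℕ) (U : Finset (ℕ × K))
    (hU : ∀ i ∈ U, i.1 ≤ L₀) (hU1 : 1 ≤ U.card) (L : Fin S.n → ℕ) {P : ℤ} (hP1 : 1 ≤ P) {w : ℝ} (hw : 0 ≤ w) {γb : ℝ} (hγb : 0 ≤ γb)
    (c : ℤ) (e : Fin S.n → ℤ) {c' : ℤ} (hc' : c' ≠ 0) {δ₀ : ℝ} (Bv : Fin S.n → ℕ)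
    {N N₁ T T' t : ℕ} (ht : 1 ≤ t) (hT : T' + t ≤ T) (hN₁ : 2 * N₁ ≤ 6 * N + 5)
    {A : Fin S.n → ℝ} (hA : ∀ k, |S.lg k| ≤ A k) {E : ℝ} (hE : 1 ≤ E) (hsmall : (L S.j₀ : ℝ) * δ₀ * (3 * N + 2) ≤ 1)
    {C : ℝ} (hC : 1 ≤ C) {V : Fin S.n → ℝ} (hV : ∀ j, Height.logHeight₁ (F.αo j) ≤ V j)
    {cU cP cb cbh cH : ℝ} (hcU : (U.card : ℝ) ≤ Real.exp cU) (hcP : (P : ℝ) ≤ Real.exp cP)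
    (hcb : 2 * ((L S.j₀ : ℝ) * δ₀ * N) ≤ Real.exp cb) (hcbh : 2 * ((L S.j₀ : ℝ) * δ₀ * (3 * N + 2)) ≤ Real.exp cbh)
    (hcH : Real.log (heightProd S.α) ≤ cH)
    (hJ : ∀ (s : ℤ) (a : ℕ), Odd s → |s| ≤ 2 * (N₁ : ℤ) - 1 → a < T' →
      γb * (3 * N + 2) + Real.log (2 * ((2 * N + 1 : ℕ) : ℝ) ^ (t + 1) * t * (20 * Real.exp 1) ^ ((2 * N + 1) * t)) +
        t * Real.log (2 * C) + γb * (N + 1) + a * Real.log 2 + (∑ k, A k * S.GammaC L k) / C + cU + cP +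
        Real.log (DΔC (S.YC c e L) T') + Real.log (WC H (ex + 1) L₀ T N) + (γb + w) * N + cb +
        (2 : ℝ) ^ S.n * (Real.log 4 + (23 / 20 * a * H + (|(s : ℝ)| * ∑ j, ((Bv j : ℝ) / F.N) * V j +
          ∑ j, ((F.colU j : ℝ) / F.N) * V j + 2 * ∑ j, V j)) +
          (Real.log 2 + cU + cP + Real.log (DΔC (S.YC c e L) T') + Real.log (S.MtV A H ex L₀ T' N₁ (γb + w))) + 2 * cH) +
        Real.log 3 ≤ 0)
    (hFl : ∀ (s : ℤ) (a : ℕ), Odd s → |s| ≤ 2 * (N₁ : ℤ) - 1 → a < T' →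
      γb * (3 * N + 2) + cU + cP + Real.log (DΔC (S.YC c e L) T') + Real.log (WC H (ex + 1) L₀ T' ((3 * E + 1) * (2 * N + 1) + N)) +
        (w + (L S.j₀ : ℝ) * δ₀) * ((3 * E + 1) * (2 * N + 1) + N) - ((2 * N + 1) * t : ℕ) * Real.log E +
        (2 : ℝ) ^ S.n * (Real.log 4 + (23 / 20 * a * H + (|(s : ℝ)| * ∑ j, ((Bv j : ℝ) / F.N) * V j +
          ∑ j, ((F.colU j : ℝ) / F.N) * V j + 2 * ∑ j, V j)) +
          (Real.log 2 + cU + cP + Real.log (DΔC (S.YC c e L) T') + Real.log (S.MtV A H ex L₀ T' N₁ (γb + w))) + 2 * cH) +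
        Real.log 3 ≤ 0)
    (hCl : ∀ (s : ℤ) (a : ℕ), Odd s → |s| ≤ 2 * (N₁ : ℤ) - 1 → a < T' →
      cU + cP + Real.log (DΔC (S.YC c e L) T') + Real.log (WC H (ex + 1) L₀ T' N₁) + (γb + w) * (3 * N + 2) + cbh +
        (2 : ℝ) ^ S.n * (Real.log 4 + (23 / 20 * a * H + (|(s : ℝ)| * ∑ j, ((Bv j : ℝ) / F.N) * V j +
          ∑ j, ((F.colU j : ℝ) / F.N) * V j + 2 * ∑ j, V j)) +
          (Real.log 2 + cU + cP + Real.log (DΔC (S.YC c e L) T') + Real.log (S.MtV A H ex L₀ T' N₁ (γb + w))) + 2 * cH) +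
        Real.log 3 < 0) :
    S.ArchHalfStepHypD (fun i : ℕ × K => scaledFeldR i.1 H (ex + 1)) (fun i : ℕ × K => scaledFeldR i.1 H ex) U L P w γb c e c' δ₀
      (fun w' => ∀ j, |(w' ᵥ* F.U) j| ≤ (Bv j : ℤ)) N N₁ T T' := by
  have hH' : (0 : ℝ) < H := by exact_mod_cast hH
  have hE0 : (0 : ℝ) ≤ E := le_trans zero_le_one hE
  have hDΔ1 : 1 ≤ DΔC (S.YC c e L) T' := one_le_DΔC (S.YC_nonneg c e L) T'
  have hWn : 0 < WC H (ex + 1) L₀ T N := lt_of_lt_of_le one_pos (one_le_WC hH (ex + 1) L₀ T (Nat.cast_nonneg N))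
  have hWd : 0 < WC H (ex + 1) L₀ T' ((3 * E + 1) * (2 * N + 1) + N) :=
    lt_of_lt_of_le one_pos (one_le_WC hH (ex + 1) L₀ T' (by positivity))
  have hWh : 0 < WC H (ex + 1) L₀ T' N₁ := lt_of_lt_of_le one_pos (one_le_WC hH (ex + 1) L₀ T' (Nat.cast_nonneg N₁))
  have hMt1 : 1 ≤ S.MtV A H ex L₀ T' N₁ (γb + w) :=
    S.one_le_MtV (fun k => (abs_nonneg _).trans (hA k)) hH ex L₀ T' N₁ (by linarith)
  have hhP : 1 ≤ heightProd S.α := CW77.one_le_heightProd S.α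
  have hP1' : (1 : ℝ) ≤ P := by exact_mod_cast hP1
  refine S.archHalfStepHypD_of_ineqV F hH ex L₀ U hU L P hw γb c e hc' Bv ht hT hN₁ hA hE hsmall hC fun s hso hs a μ haμ => ?_
  have ha : a < T' := by omega
  have hDn : 1 ≤ (Nat.lcmUpto H) ^ a * F.Dhv Bv s := F.one_le_lcm_pow_mul_Dhv H a Bv s
  have hD := F.log_lcm_pow_mul_Dhv_le (H := H) a Bv s hV
  exact halfstep_ineq_of_logLines ht hC hE hDΔ1 hWn hWd hWh hMt1 hP1' hU1 hhP hDn hcU hcP hcb hcbh hD hcH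
    (hJ s a hso hs ha) (hFl s a hso hs ha) (hCl s a hso hs ha)

end ArchG3Setup

end Summit.ABC.StewartYu

end
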